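import Summits.ResolutionOfSingularities.ResolutionOfSingularities.Theorems.WeightedInvariantIota3PresThree
import Summits.ResolutionOfSingularities.ResolutionOfSingularities.Theorems.WeightedInvariantContactCylinderGenericSuccessorClause
import Summits.ResolutionOfSingularities.ResolutionOfSingularities.Theorems.WeightedInvariantHypersurfaceLocalGameEFT4SDimLETwoGame
import Summits.ResolutionOfSingularities.ResolutionOfSingularities.Theorems.WeightedInvariantKWildHomDrop
import Summits.ResolutionOfSingularities.ResolutionOfSingularities.Theorems.WeightedInvariantP3tDrop
import HarnessLib

/-!
# (DROP)₃, TYPE (a) PROVED: `ι₃ᵗ` drops at every successor over the GENERIC point of the canonical centre; (DROP)₃ reduces to the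
# `t`-homogeneous successors over the CLOSED point (door `HypersurfaceCentreConstruction`, stmt-ResolutionOfSingularities-19897)

Helper for `stub_keyRungGrHomLE_three` (def-free, `--supports 19897`).  Sequel of …Iota3PresThree (gap list
`keyRungGrHomLE_three_of_tieDescent_drop` = hD + (DROP)₃).  (DROP)₃ asks, at a door position `(S, f)` with canonical centre `P`
(`topStratum ι₀ S f = V(P)`) and a weighted presentation `(u, w)` of `(P, J₃ᵗ)`, for the drop `ι₃ᵗ(B_𝔫)(g) < ι₃ᵗ(S)(f)` at the
`t`-homogeneous successor primes `𝔫` of the cobordant algebra `B = cobordantAlgebra' u w` (`t⁻¹ ∈ 𝔫`, `P·B ≤ 𝔫`, `𝔫 ⊉ vertex`,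
`f = (t⁻¹)ᵃ g`, `t⁻¹ ∤ g`, `g ∈ 𝔪_𝔫²`).  The successors split by `𝔫 ∩ S ⊇ P`:

* **`Iota3.iotaFlatT_successor_lt_of_over_generic_point`** — TYPE (a), `𝔫 ∩ S = P` with `dim S_P ≤ 2` (the curve and divisor-in-surface
  centres): THE DROP HOLDS, for every successor (homogeneous or not) and every presentation `(u, w)` with
  `weightedMonomialIdeal u w m = jFlatT S f m`.  Proof: `J₃ᵗ S f m` is the cylinder over `P` of `jContact (S_P) (f/1)`
  (`jFlatT_eq_cylinderAt_jContact`), hence contracted from `S_P` with value `jContact (S_P) (f/1)` there; the P2 rung's canonical game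
  clause `CanonicalGameClauseLE 2 p iotaOrd jContact` (`LocalGameEFTDimTwoGame.canonicalGameClauseLE2_iotaOrd_jContact`, a tree theorem)
  and res-type-005's TYPE (a) consumer `ContactCylinder.iota_successor_lt_of_over_generic_point_of_clause` give the ORDER drop
  `iotaOrd (B_𝔫) g < iotaOrd S f` (`ord_{S_P} f = ord_S f` on the top stratum); an order drop is an `ι₃ᵗ` drop
  (`iotaFlatT_lt_of_iotaOrd_lt`: `ι₃ᵗ = lex(ν ; ε ; τ ; σ-cylinder)` with the order as first letter).
* **`Iota3.weightedDropHom_of_drop_over_closedPoint`** — when the primes above `P` are `P` and `𝔪` only (`dim S ⧸ P ≤ 1`: the point and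
  curve regimes), `WeightedDropHom iotaFlatT S f P u w` ⟸ the drop at the `t`-homogeneous successors OVER THE CLOSED POINT (`𝔪·B ≤ 𝔫`).

So (DROP)₃ = TYPE (a) ✓ + (D-b) «drop at `t`-homogeneous successors over `𝔪`» [XL, the crux] + (D-div) the divisor-in-threefold centres
(`ht P = 1`, `dim S = 3`, successors over intermediate primes `P < Q < 𝔪`) [M–L; expected vacuous: `f = unit · π^ν` along `V(π) = V(P)`].
[OURS · L1 W4.3 · audit glue; AI work, weaker than expert review; nothing here is a statement of the manuscript under review
(Hironaka 2017, [claim: Hironaka2017, status: under-review]).]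

## References

* J. Włodarczyk, *Functorial resolution by torus actions*, arXiv:2203.03090, Def. 2.3.5, App. Def. 5.1.1 (cobordant blow-up, charts). [Wlodarczyk2022]
* V. Cossart, U. Jannsen, S. Saito, *Desingularization: invariants and strategy*, LNM 2270 (2020), Ch. 8 (order drop under permissible
  blow-ups of two-dimensional hypersurfaces). [CossartJannsenSaito2020]
* res-L1-w43-plan-1 IOTA3-DESIGN v1.3 §8.4 (regimes), res-type-092 O36-DESIGN §2 (TYPE (a)/(b) split) (OURS, AI planning).
-/

noncomputable section

set_option linter.dupNamespace false -- mandated namespace of this single-conjunct summit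

open IsLocalRing Literature.AlgebraicGeometry.Resolution
open Summit.ResolutionOfSingularities.ResolutionOfSingularities.Theorems
open Summit.ResolutionOfSingularities.ResolutionOfSingularities.Theorems.ContactCylinder

namespace Summit.ResolutionOfSingularities.ResolutionOfSingularities.Cruxes.HypersurfaceCentreConstruction.LocalEngine

namespace Iota3

/-! ## §1 An order drop is an `ι₃ᵗ` drop -/

/-- **An ORDER drop is an `ι₃ᵗ` drop**: `iotaOrd R g < iotaOrd R' g' → iotaFlatT R g < iotaFlatT R' g'` (`ι₃ᵗ = lex(ν ; ε ; τ ; σ-cylinder)`,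
first letter the order: `iotaFlatT_lt_iff`, `iotaOrdEpsTau_lt_iff`, `iotaOrdEps_lt_iff`). [OURS · L1 W4.3] -/
theorem iotaFlatT_lt_of_iotaOrd_lt (R : Type) [CommRing R] (g : R) (R' : Type) [CommRing R'] (g' : R')
    (h : iotaOrd R g < iotaOrd R' g') : iotaFlatT R g < iotaFlatT R' g' :=
  (iotaFlatT_lt_iff R g R' g').mpr (Or.inl ((iotaOrdEpsTau_lt_iff R g R' g').mpr
    (Or.inl ((iotaOrdEps_lt_iff R g R' g').mpr (Or.inl h)))))

/-! ## §2 TYPE (a): successors over the generic point of the centre -/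

/-- **(DROP)₃, TYPE (a) — `ι₃ᵗ` DROPS AT EVERY SUCCESSOR OVER THE GENERIC POINT OF THE CANONICAL CENTRE.**  `k₀` perfect of
characteristic `p`; `S` regular local, essentially of finite type over `k₀`; `0 ≠ f ∈ 𝔪²`; `P` prime with `topStratum ι₀ S f = V(P)` and
`dim S_P ≤ 2`; `(u, w)` any family with `weightedMonomialIdeal u w m = jFlatT S f m` for all `m`.  Then for every prime `𝔫` of
`B = cobordantAlgebra' u w` with `t⁻¹ ∈ 𝔫`, `P·B ≤ 𝔫`, `𝔫 ⊉ vertex` and `𝔫 ∩ S ≤ P`, and every `f = (t⁻¹)ᵃ g`, `t⁻¹ ∤ g`, `g/1 ∈ 𝔪_𝔫²`: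
`iotaFlatT (B_𝔫) (g/1) < iotaFlatT S f`.  (`J₃ᵗ` is the cylinder over `P` of `jContact (S_P) (f/1)`; the P2 canonical game clause for
`(iotaOrd, jContact)` and the TYPE (a) consumer of res-type-005 drop the ORDER; an order drop is an `ι₃ᵗ` drop.)
[OURS · L1 W4.3 · (DROP)₃ TYPE (a)] -/
theorem iotaFlatT_successor_lt_of_over_generic_point (p : ℕ) (k₀ : Type) [Field k₀] [CharP k₀ p] [PerfectField k₀]
    (S : Type) [CommRing S] [IsRegularLocalRing S] [Algebra k₀ S] [Algebra.EssFiniteType k₀ S]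
    {f : S} (hf0 : f ≠ 0) (hf2 : f ∈ (maximalIdeal S) ^ 2)
    (P : Ideal S) [P.IsPrime] (hE : topStratum iotaOrdEpsTau S f = {𝔮 | P ≤ 𝔮.asIdeal})
    (hdimP : ringKrullDim (Localization.AtPrime P) ≤ 2)
    {n : ℕ} (u : Fin n → S) (w : Fin n → ℕ) (hpres : ∀ m : ℕ, weightedMonomialIdeal u w m = jFlatT S f m)
    (𝔫 : Ideal (cobordantAlgebra' u w)) [𝔫.IsPrime] (hT : cobordantT' u w ∈ 𝔫)
    (hP𝔫 : P.map (algebraMap S (cobordantAlgebra' u w)) ≤ 𝔫)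
    (hV : ¬ extReesAlgebra.vertexIdeal (weightedMonomialIdeal u w) ≤ 𝔫)
    (hgen : 𝔫.comap (algebraMap S (cobordantAlgebra' u w)) ≤ P)
    (a : ℕ) (g : cobordantAlgebra' u w) (hfg : algebraMap S (cobordantAlgebra' u w) f = cobordantT' u w ^ a * g)
    (hTg : ¬ cobordantT' u w ∣ g)
    (hg2 : algebraMap (cobordantAlgebra' u w) (Localization.AtPrime 𝔫) g ∈ maximalIdeal (Localization.AtPrime 𝔫) ^ 2) :
    iotaFlatT (Localization.AtPrime 𝔫) (algebraMap (cobordantAlgebra' u w) (Localization.AtPrime 𝔫) g) < iotaFlatT S f := by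
  haveI : IsDomain S := isDomain_of_isRegularLocalRing S
  -- the position `(S_P, f/1)`
  have hf0' : algebraMap S (Localization.AtPrime P) f ≠ 0 := fun h =>
    hf0 ((injective_iff_map_eq_zero _).mp
      (IsLocalization.injective (Localization.AtPrime P) P.primeCompl_le_nonZeroDivisors) f h)
  have hf2' : algebraMap S (Localization.AtPrime P) f ∈ maximalIdeal (Localization.AtPrime P) ^ 2 :=
    algebraMap_mem_maximalIdeal_sq_of_topStratum S hf2 hE P le_rfl
  have hιP : iotaOrd (Localization.AtPrime P) (algebraMap S (Localization.AtPrime P) f) = iotaOrd S f := by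
    have hmem : (⟨P, ‹_›⟩ : PrimeSpectrum S) ∈ topStratum iotaOrdEpsTau S f := by
      rw [hE]
      exact (le_rfl : P ≤ P)
    have h0 : iotaOrdEpsTau (Localization.AtPrime P) (algebraMap S (Localization.AtPrime P) f) = iotaOrdEpsTau S f := hmem
    exact ((iotaOrdEps_eq_iff _ _ _ _).mp ((iotaOrdEpsTau_eq_iff _ _ _ _).mp h0).1).1
  -- `J₃ᵗ S f` is the cylinder over `P` of `jContact (S_P) (f/1)`: contracted, with that value
  have hJ : ∀ m : ℕ, weightedMonomialIdeal u w m =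
      (jContact (Localization.AtPrime P) (algebraMap S (Localization.AtPrime P) f) m).comap
        (algebraMap S (Localization.AtPrime P)) := fun m => by
    rw [hpres m, jFlatT_eq_cylinderAt_jContact S f m hE hdimP, cylinderAt_def]
  have hval : ∀ m : ℕ, (weightedMonomialIdeal u w m).map (algebraMap S (Localization.AtPrime P)) =
      jContact (Localization.AtPrime P) (algebraMap S (Localization.AtPrime P) f) m := fun m => by
    rw [hJ m]
    exact IsLocalization.map_under P.primeCompl _ _
  have hcontr : ∀ m : ℕ, ((weightedMonomialIdeal u w m).map (algebraMap S (Localization.AtPrime P))).comap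
      (algebraMap S (Localization.AtPrime P)) = weightedMonomialIdeal u w m := fun m => by
    rw [hval m, ← hJ m]
  -- the P2 canonical game clause for `(iotaOrd, jContact)` drops the ORDER at TYPE (a) successors
  have hdim2 : ringKrullDim (Localization.AtPrime P) ≤ (2 : ℕ) := by exact_mod_cast hdimP
  have hord := iota_successor_lt_of_over_generic_point_of_clause iotaOrd_isoInvariant
    ((canonicalGameClauseLE_two_iff p iotaOrd jContact).mpr (LocalGameEFTDimTwoGame.canonicalGameClauseLE2_iotaOrd_jContact p))
    k₀ S P hdim2 f hf0' hf2' hιP u w hcontr hval 𝔫 hT hP𝔫 hV hgen a g hfg hTg hg2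
  exact iotaFlatT_lt_of_iotaOrd_lt _ _ _ _ hord

/-! ## §3 (DROP)₃ reduces to the successors over the closed point -/

/-- **(DROP)₃ ⟸ THE DROP OVER THE CLOSED POINT**, when the primes of `S` above the centre `P` are `P` and `𝔪_S` only (the point and
curve regimes, `dim S ⧸ P ≤ 1`) and `dim S_P ≤ 2`: `WeightedDropHom iotaFlatT S f P u w` follows from the drop of `ι₃ᵗ` at the
`t`-homogeneous successor primes `𝔫` with `𝔪_S · B ≤ 𝔫` (TYPE (b)); the successors with `𝔫 ∩ S = P` (TYPE (a)) drop by
`iotaFlatT_successor_lt_of_over_generic_point`. [OURS · L1 W4.3 · (DROP)₃ split] -/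
theorem weightedDropHom_of_drop_over_closedPoint (p : ℕ) (k₀ : Type) [Field k₀] [CharP k₀ p] [PerfectField k₀]
    (S : Type) [CommRing S] [IsRegularLocalRing S] [Algebra k₀ S] [Algebra.EssFiniteType k₀ S]
    {f : S} (hf0 : f ≠ 0) (hf2 : f ∈ (maximalIdeal S) ^ 2)
    (P : Ideal S) [P.IsPrime] (hE : topStratum iotaOrdEpsTau S f = {𝔮 | P ≤ 𝔮.asIdeal})
    (hdimP : ringKrullDim (Localization.AtPrime P) ≤ 2)
    (hchain : ∀ (Q : Ideal S) [Q.IsPrime], P ≤ Q → Q ≠ maximalIdeal S → Q = P)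
    {n : ℕ} (u : Fin n → S) (w : Fin n → ℕ) (hpres : ∀ m : ℕ, weightedMonomialIdeal u w m = jFlatT S f m)
    (hb : ∀ (𝔫 : Ideal (cobordantAlgebra' u w)) [𝔫.IsPrime], IsTHomogeneous u w 𝔫 → cobordantT' u w ∈ 𝔫 →
      (maximalIdeal S).map (algebraMap S (cobordantAlgebra' u w)) ≤ 𝔫 →
      ¬ extReesAlgebra.vertexIdeal (weightedMonomialIdeal u w) ≤ 𝔫 →
      ∀ (a : ℕ) (g : cobordantAlgebra' u w), algebraMap S (cobordantAlgebra' u w) f = cobordantT' u w ^ a * g →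
        ¬ cobordantT' u w ∣ g →
        algebraMap (cobordantAlgebra' u w) (Localization.AtPrime 𝔫) g ∈ maximalIdeal (Localization.AtPrime 𝔫) ^ 2 →
        iotaFlatT (Localization.AtPrime 𝔫) (algebraMap (cobordantAlgebra' u w) (Localization.AtPrime 𝔫) g) < iotaFlatT S f) :
    WeightedDropHom iotaFlatT S f P u w := by
  intro 𝔫 _ hhom hT hP𝔫 hV a g hfg hTg hg2
  haveI hQ : (𝔫.comap (algebraMap S (cobordantAlgebra' u w))).IsPrime := Ideal.IsPrime.comap _
  have hPQ : P ≤ 𝔫.comap (algebraMap S (cobordantAlgebra' u w)) := fun x hx =>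
    Ideal.mem_comap.mpr (hP𝔫 (Ideal.mem_map_of_mem _ hx))
  by_cases hQm : 𝔫.comap (algebraMap S (cobordantAlgebra' u w)) = maximalIdeal S
  · exact hb 𝔫 hhom hT (by rw [← hQm]; exact Ideal.map_comap_le) hV a g hfg hTg hg2
  · have hQP : 𝔫.comap (algebraMap S (cobordantAlgebra' u w)) = P := hchain _ hPQ hQm
    exact iotaFlatT_successor_lt_of_over_generic_point p k₀ S hf0 hf2 P hE hdimP u w hpres 𝔫 hT hP𝔫 hV hQP.le
      a g hfg hTg hg2

end Iota3

end Summit.ResolutionOfSingularities.ResolutionOfSingularities.Cruxes.HypersurfaceCentreConstruction.LocalEngine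

end
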